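import Summits.FinalStateConjecture.FinalStateConjecture.Theorems.ZeroEnergyKerrOrBombStationaryLimitReductionRecutCoveringJunctionCore
import Literature.Geometry.Lorentzian.CausalFutureProofs
import HarnessLib

/-!
# Route ZeroEnergyKerrOrBomb · crux `FinalStateFromKerrOrBomb` (stmt-FinalStateConjecture-17839), line
# `SketchIdeator1` — stub `stub_recutJunctionCoreCO`, wave 5: ASSEMBLY of the junction core over the
# chart-overlap clause with isochronous motions, from case F, ingredient (α) and the near-horizon residual (NH)

Helper file (`--supports stmt-FinalStateConjecture-17839`; registered helper `recutJunctionCoreCO_of_isochronous`)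
of the lead's wave-5 stub worker W16 (2026-08-17); companion of `…RecutCoreCOFlatSteer.lean` (case F,
`recutJunction_flatSteer`, proposed the same day) and of `…RecutCoreCOIsochronous.lean` (the motions ARE
isochronous under the core's binders). See `work/stubs/W16-report.md`.

The statement: the conclusion of `SigM.stub_recutJunctionCoreCO` (skeleton `SketchIdeator1`, m4) VERBATIM, over a
general spacetime `𝓢` and region `O`, from the sub-list of its binders that the assembly consumes — monotone radii
`Rᵢ → ∞`, the overlap-margin clause (iii) and the exhaustiveness clause (ii) of `HasExhaustiveDocCharts'` (source
`O ∩ I⁻(docCharted d)`), Kerr identifications, the no-double-coordinate clause (b) of `IsChartOverlapCompatible` —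
plus `cᵢ = 1` (p144329), isochronous motions `Λᵢ e₀ = e₀` (companion file), and three layer conclusions as
hypotheses: ingredient (α) for `r ≥ r₊ + δ` (p141985), the near-horizon residual (NH) (open), and case F
(`recutJunction_flatSteer`).

Proof (W15's plan, W16 form). Fix `s, W ≥ 0`, radii `R'ᵢ τ = Rᵢ(τ − s) − W`, tilt/radius bound `L`, offset bound
`κ ≥ |cᵢ⁰|`. For late `τ₁` put `τ₂ := τ₁ − L − 2κ − 1` and apply clause (ii) at `τ₂` to a point `p` of
`O ∩ I⁻(docCharted d)` outside `Ω := recutCertifiedLate … R' τ₁`: (1) `p` flat-late after `τ₂`: case F; (2) `p` below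
a flat slab point `q` of lab time `τ₂`: `q ∉ Ω` (Ω-test, §2: a flat event of lab time `≤ τ₁ − L − κ` is never in `Ω`,
by (b) and the tilt bound), case F for `q`, transitivity; (3) `p` in an old d.o.c. tube after `τ₂` / (4) `p` below an
old d.o.c. slab point `q` at `τ₂`: the hole-point steering (§3): with Kerr–Schild coordinate `x`, either `x⁰ ≤ τ₁`
and `r(x) ≤ R' τ₁` ((α) / (NH)), or the point is in `Ω` (excluded), or its adapted radius exceeds
`Rᵢ(σ − L − s) − W − L` and clause (iii) + (b) make it a FLAT event of lab time `σ + cᵢ⁰ ≤ τ₁`: case F.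

Elementary; no named fact, nothing restated. Reference: Dafermos–Luk arXiv:1710.01722, Conjecture 1 (b)–(c)
(late-time multi-chart bookkeeping; formalisation-internal).
-/

set_option linter.dupNamespace false

noncomputable section

open scoped Manifold ContDiff Topology
open Set Filter Function

namespace Summit.FinalStateConjecture.FinalStateConjecture.Theorems.SymplecticDualOfTheBomb

open Literature.Geometry.Lorentzian Summit.FinalStateConjecture.FinalStateConjecture.Theorems.OneLockedExplosion

/-! ## §1 Private copies (sibling modules unbuilt today) -/

section Causal

variable {E : Type*} [NormedAddCommGroup E] [NormedSpace ℝ E] {H : Type*} [TopologicalSpace H]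
  {I : ModelWithCorners ℝ E H} {n : ℕ∞ω} {M : Type*} [TopologicalSpace M] [ChartedSpace H M]
  [IsManifold I ∞ M] {g : LorentzianMetric I n M} {τ : TimeOrientation g}

/-- Private copy of `exists_mem_causalPast_singleton_of_mem_causalPast` (…RecutJunctionCore, unbuilt today): a
point of `J⁻(S)` is in `J⁻` of a single point of `S`. O'Neill 1983, Ch. 14, p. 403. [folklore] -/
private theorem exists_mem_causalPast_singleton_w5 {S : Set M} {p : M} (hp : p ∈ g.causalPast τ S) :
    ∃ q ∈ S, p ∈ g.causalPast τ ({q} : Set M) := by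
  rcases hp with hp | ⟨q, hq, h⟩
  · exact ⟨p, hp, LorentzianMetric.subset_causalPast g τ _ (mem_singleton p)⟩
  · exact ⟨q, hq, Or.inr ⟨q, mem_singleton q, h⟩⟩

/-- Private copy of `causalPast_subset_causalPast_of_subset` (…RecutJunctionCore, unbuilt today): transitivity of
`J⁻` for sets, `T ⊆ J⁻(S) ⟹ J⁻(T) ⊆ J⁻(S)` (`C²` metric, no boundary). O'Neill 1983, Ch. 14, p. 402. [folklore] -/
private theorem causalPast_subset_causalPast_of_subset_w5 [BoundarylessManifold I M] (hn : 2 ≤ n) {S T : Set M}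
    (hT : T ⊆ g.causalPast τ S) : g.causalPast τ T ⊆ g.causalPast τ S := fun p hp ↦ by
  have h : p ∈ g.causalFuture τ.reverse (g.causalFuture τ.reverse S) := LorentzianMetric.causalFuture_mono hT hp
  rwa [LorentzianMetric.causalFuture_causalFuture_eq hn S] at h

end Causal

section Copies

variable {𝓢 : Spacetime.{0} 4} {O : Set 𝓢.carrier} {k : ℕ} {Λ : lorentzGroup}

/-- Private copy of `lorentz_apply_zero_of_map_basisVector` (…RecutCoreCOFlatSteer, unbuilt today): an isochronous
Lorentz transformation preserves the time coordinate. [folklore] -/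
private theorem lorentz_apply_zero_w5 (hΛ : (Λ : E4 ≃L[ℝ] E4) (E4.basisVector 0) = E4.basisVector 0) (v : E4) :
    (Λ : E4 ≃L[ℝ] E4) v 0 = v 0 := by
  have h := Λ.2 (E4.basisVector 0) v
  rw [hΛ, Minkowski.bilin_basisVector_zero_left, Minkowski.bilin_basisVector_zero_left] at h
  linarith

/-- Private copy of `poincareInv_apply_zero_of_map_basisVector` (…RecutCoreCOFlatSteer, unbuilt today): rest time of
an isochronous motion, `(P⁻¹ y)⁰ = y⁰ − c⁰`. [folklore] -/
private theorem poincareInv_apply_zero_w5 (hΛ : (Λ : E4 ≃L[ℝ] E4) (E4.basisVector 0) = E4.basisVector 0)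
    (c₀ y : E4) : poincareInv Λ c₀ y 0 = y 0 - c₀ 0 := by
  have h := lorentz_apply_zero_w5 hΛ ((Λ : E4 ≃L[ℝ] E4).symm (y - c₀))
  rw [ContinuousLinearEquiv.apply_symm_apply] at h
  rw [poincareInv, ← h]
  rfl

variable (d : StationaryFinalStateDecomposition 𝓢 O k) {M a c r₀ : Fin d.N → ℝ} {Θ : Fin d.N → E4 → E4}

/-- Private copy of `kerrChartedWith_radius_le_adaptedRadius_add` (…RecutCoreCOFlatSteer, unbuilt today): two-sided
radius comparison `r(u) ≤ A.radius (Θ u) + L₂` on the Kerr exterior. [folklore] -/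
private theorem radius_le_adaptedRadius_add_w5 {𝓑 : StationaryAFBlackHole.{0}} {A : 𝓑.AdaptedChart}
    {M a c r₀ : ℝ} {Θ : E4 → E4} (h : IsKerrChartedWith 𝓑 A M a c r₀ Θ) :
    ∃ L₂ : ℝ, 0 ≤ L₂ ∧ ∀ u ∈ (Kerr.exterior M a : Set E4), Kerr.radius a u ≤ A.radius (Θ u) + L₂ := by
  obtain ⟨hsub, -, -, -, -, -, -, -, -, -, L, hL⟩ := h
  obtain ⟨C, hC⟩ := A.exists_abs_radius_sub_spatialNorm_le
  have hrp : 0 < Kerr.rPlus M a := hsub.pos.trans_le (le_add_of_nonneg_right (Real.sqrt_nonneg _))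
  refine ⟨|L| + |C| + Kerr.rPlus M a + 1, by positivity, fun u hu ↦ ?_⟩
  by_cases hfar : Kerr.rPlus M a + 1 ≤ Kerr.radius a u
  · have h1 := (abs_le.1 (hL u hu hfar).2.1).1
    linarith [le_abs_self L, abs_nonneg C]
  · have h1 := (abs_le.1 (hC (Θ u))).1
    have h2 : 0 ≤ E4.spatialNorm (Θ u) := E4.spatialNorm_nonneg _
    linarith [le_abs_self C, abs_nonneg L, not_le.1 hfar]

/-- Private copy of `exists_kerr_of_mem_docPart` (…RecutCoreCOFlatSteer, unbuilt today): a d.o.c.-part coordinate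
has Kerr–Schild coordinates (anchor clause). [folklore] -/
private theorem exists_kerr_of_mem_docPart_w5 {i : Fin d.N}
    (hW : IsKerrChartedWith (d.hole i) (d.adapted i) (M i) (a i) (c i) (r₀ i) (Θ i))
    {y : (d.background i).domain} (hy : y ∈ docPart d i) :
    ∃ x ∈ (Kerr.exterior (M i) (a i) : Set E4), Θ i x = poincareInv (d.motion i).1 (d.motion i).2 y.1 := by
  have h : poincareInv (d.motion i).1 (d.motion i).2 y.1 ∈ Θ i '' (Kerr.exterior (M i) (a i) : Set E4) := by
    rw [hW.2.2.2.2.2.2.2.2.2.1]; exact hy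
  obtain ⟨x, hx, hxy⟩ := h
  exact ⟨x, hx, hxy⟩

/-- Private copy of `chart_mem_recutCertifiedLate_of_kerr` (…RecutCoreCOFlatSteer, unbuilt today): membership in
the recut certified tube from the Kerr–Schild data. [folklore] -/
private theorem chart_mem_recutCertifiedLate_of_kerr_w5 {i : Fin d.N} (R' : Fin d.N → ℝ → ℝ) {τ₁ : ℝ}
    {x : E4} (hx : x ∈ (Kerr.exterior (M i) (a i) : Set E4)) (hx0 : τ₁ < x 0)
    (hxr : Kerr.radius (a i) x ≤ R' i (x 0))
    (h₀ : ((d.motion i).1 : E4 ≃L[ℝ] E4) (Θ i x) + (d.motion i).2 ∈ (d.background i).domain) :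
    d.toOver.chart i ⟨((d.motion i).1 : E4 ≃L[ℝ] E4) (Θ i x) + (d.motion i).2, h₀⟩ ∈
      recutCertifiedLate d M a Θ R' τ₁ := by
  set z : E4 := ((d.motion i).1 : E4 ≃L[ℝ] E4) x + (d.motion i).2 with hz
  have hPz : poincareInv (d.motion i).1 (d.motion i).2 z = x := poincareInv_apply_add _ _ _
  have hzdom : z ∈ ((recutBackground d M a i).domain : Set E4) := by
    show poincareInv (d.motion i).1 (d.motion i).2 z ∈ (Kerr.exterior (M i) (a i) : Set E4)
    rw [hPz]; exact hx
  refine Or.inr (mem_iUnion.2 ⟨i, mem_image_of_mem _ ?_⟩)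
  refine ⟨z, ⟨⟨z, hzdom⟩, ⟨?_, ?_⟩, rfl⟩, ?_⟩
  · show τ₁ < (poincareInv (d.motion i).1 (d.motion i).2 z) 0
    rw [hPz]; exact hx0
  · show Kerr.radius (a i) (poincareInv (d.motion i).1 (d.motion i).2 z) ≤
      R' i ((poincareInv (d.motion i).1 (d.motion i).2 z) 0)
    rw [hPz]; exact hxr
  · show ((d.motion i).1 : E4 ≃L[ℝ] E4) (Θ i (poincareInv (d.motion i).1 (d.motion i).2 z)) + (d.motion i).2 = _
    rw [hPz]

end Copies

/-! ## §2 The Ω-test: early flat events are never recut-late -/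

section OmegaTest

variable {𝓢 : Spacetime.{0} 4} {O : Set 𝓢.carrier} {k : ℕ}
  (d : StationaryFinalStateDecomposition 𝓢 O k) {M a c r₀ : Fin d.N → ℝ} {Θ : Fin d.N → E4 → E4}

/-- **Ω-test.** With isochronous motions, Kerr identifications of tilt `≤ L` (`cᵢ = 1`), offsets `|cᵢ⁰| ≤ κ` and the
no-double-coordinate clause (b): a flat event `Ψ₀ y` of lab time `τ₀ < y⁰ ≤ τ₁ − L − κ` is not in
`recutCertifiedLate d M a Θ R' τ₁` for any radii `R'` (its flat label is not late after `τ₁` — injectivity of `Ψ₀` on the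
late region —, and a recut tube point of Kerr–Schild time `> τ₁` has a doubly-late hole label of lab time
`> τ₁ − L − κ`, which (b) identifies with `y`). [folklore] -/
theorem flatChart_not_mem_recutCertifiedLate
    (hiso : ∀ i, ((d.motion i).1 : E4 ≃L[ℝ] E4) (E4.basisVector 0) = E4.basisVector 0)
    (hb : ∀ (i : Fin d.N) (y : (d.background i).domain) (y' : d.toOver.flatDomain),
      d.toOver.τ₀ < (d.background i).time y.1 → d.toOver.τ₀ < (y : E4) 0 → d.toOver.τ₀ < (y' : E4) 0 →
        d.toOver.chart i y = d.toOver.flatChart y' → (y : E4) = y')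
    {L κ : ℝ} (hL : ∀ i, ∀ u ∈ (Kerr.exterior (M i) (a i) : Set E4), |Θ i u 0 - u 0| ≤ L)
    (hκ : ∀ i, |(d.motion i).2 0| ≤ κ) (R' : Fin d.N → ℝ → ℝ) {τ₁ : ℝ} (hτ : d.toOver.τ₀ < τ₁ - L - κ)
    (hL0 : 0 ≤ L) (hκ0 : 0 ≤ κ) (y : d.toOver.flatDomain) (hy₀ : d.toOver.τ₀ < (y : E4) 0)
    (hy₁ : (y : E4) 0 ≤ τ₁ - L - κ) :
    d.toOver.flatChart y ∉ recutCertifiedLate d M a Θ R' τ₁ := by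
  rintro (⟨y', hy', heq⟩ | h)
  · -- the flat late region after `τ₁`: injectivity of `Ψ₀` on the late region
    have hy'late : d.toOver.τ₀ < (y' : E4) 0 := lt_trans (by linarith) hy'
    have hinj := d.toOver.isLateChart_flat.isOpenEmbedding.injective
    have h1 : (⟨y', hy'late⟩ : (Minkowski.backgroundOn d.toOver.flatDomain).lateRegion d.toOver.τ₀) = ⟨y, hy₀⟩ :=
      hinj heq
    have h2 : y' = y := congrArg Subtype.val h1
    have h3 : τ₁ < (y : E4) 0 := by rw [← h2]; exact hy'
    linarith
  · -- a recut tube point of Kerr–Schild time `> τ₁`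
    obtain ⟨i, hi⟩ := mem_iUnion.1 h
    obtain ⟨yj, ⟨z, ⟨⟨z', hz'⟩, ⟨hzt, -⟩, rfl⟩, hrecut⟩, heq⟩ := hi
    set u : E4 := poincareInv (d.motion i).1 (d.motion i).2 z' with hu
    have hux : u ∈ (Kerr.exterior (M i) (a i) : Set E4) := hz'
    have hu0 : τ₁ < u 0 := hzt
    have hyj : (yj : E4) = ((d.motion i).1 : E4 ≃L[ℝ] E4) (Θ i u) + (d.motion i).2 := hrecut.symm
    have htilt := (abs_le.1 (hL i u hux)).1
    have hrest : (d.background i).time yj.1 = Θ i u 0 := by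
      show (poincareInv (d.motion i).1 (d.motion i).2 yj.1) 0 = Θ i u 0
      rw [hyj, poincareInv_apply_add]
    have hlab : (yj : E4) 0 = Θ i u 0 + (d.motion i).2 0 := by
      rw [hyj]
      show (((d.motion i).1 : E4 ≃L[ℝ] E4) (Θ i u) + (d.motion i).2) 0 = _
      rw [PiLp.add_apply, lorentz_apply_zero_w5 (hiso i)]
    have hc0 := (abs_le.1 (hκ i)).1
    have hyjrest : d.toOver.τ₀ < (d.background i).time yj.1 := by rw [hrest]; linarith
    have hyjlab : d.toOver.τ₀ < (yj : E4) 0 := by rw [hlab]; linarith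
    have hyy : (yj : E4) = y := hb i yj y hyjrest hyjlab hy₀ heq
    have h3 : (y : E4) 0 = Θ i u 0 + (d.motion i).2 0 := by rw [← hyy, hlab]
    linarith

end OmegaTest

/-! ## §3 The assembly -/

/-- **Registered helper `recutJunctionCoreCO_of_isochronous`** (the junction core over the chart-overlap clause from
its layers). Hypotheses: monotone radii `Rᵢ → ∞`, clause (iii), clause (ii) with source `O ∩ I⁻(docCharted d)`, Kerr
identifications, `cᵢ = 1`, isochronous motions `Λᵢ e₀ = e₀`, clause (b) of `IsChartOverlapCompatible`, and the
conclusions of ingredient (α) (`r ≥ r₊ + δ` form), of the near-horizon residual (NH) and of case F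
(`recutJunction_flatSteer`). Conclusion: the conclusion of `SigM.stub_recutJunctionCoreCO` verbatim. [folklore] -/
theorem recutJunctionCoreCO_of_isochronous : ∀ {𝓢 : Spacetime.{0} 4} {O : Set 𝓢.carrier} {k : ℕ} (d : StationaryFinalStateDecomposition 𝓢 O k) (M a c r₀ : Fin d.N → ℝ) (Θ : Fin d.N → E4 → E4) (R : Fin d.N → ℝ → ℝ), (∀ i, Monotone (R i)) → (∀ i, Tendsto (R i) atTop atTop) → (∀ i, ∀ W s₀ : ℝ, ∀ᶠ σ in atTop, d.toOver.chart i '' ({x | (d.background i).time x.1 = σ ∧ R i (σ - s₀) - W ≤ (d.background i).radius x.1} ∩ docPart d i) ⊆ d.toOver.radiationZone) → (∀ τ₁ : ℝ, d.toOver.τ₀ < τ₁ → (O ∩ 𝓢.metric.chronologicalPast 𝓢.timeOrientation (docCharted d)) \ docCertifiedLate d R τ₁ ⊆ 𝓢.metric.causalPast 𝓢.timeOrientation (docCertifiedSlab d R τ₁)) → (∀ i, IsKerrChartedWith (d.hole i) (d.adapted i) (M i) (a i) (c i) (r₀ i) (Θ i)) → (∀ i, c i = 1) → (∀ i, ((d.motion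 i).1 : E4 ≃L[ℝ] E4) (E4.basisVector 0) = E4.basisVector 0) → (∀ (i : Fin d.N) (y : (d.background i).domain) (y' : d.toOver.flatDomain), d.toOver.τ₀ < (d.background i).time y.1 → d.toOver.τ₀ < (y : E4) 0 → d.toOver.τ₀ < (y' : E4) 0 → d.toOver.chart i y = d.toOver.flatChart y' → (y : E4) = y') → (∀ (i : Fin d.N) (δ : ℝ), 0 < δ → ∃ T : ℝ, ∀ (R' : Fin d.N → ℝ → ℝ) (τ₁ : ℝ), ∀ x ∈ (Kerr.exterior (M i) (a i) : Set E4), Kerr.rPlus (M i) (a i) + δ ≤ Kerr.radius (a i) x → T ≤ Θ i x 0 → (d.adapted i).radius (Θ i x) ≤ R i (Θ i x 0) → x 0 ≤ τ₁ → Kerr.radius (a i) x ≤ R' i τ₁ → ∀ h₀ : ((d.motion i).1 : E4 ≃L[ℝ] E4) (Θ i x) + (d.motion i).2 ∈ (d.background i).domain, d.toOver.chart i ⟨((d.motion i).1 : E4 ≃L[ℝ] E4) (Θ i x) + (d.motion i).2, h₀⟩ ∈ 𝓢.metric.causalPast 𝓢.timeOrientation (recutCertifiedSlab d M a Θ R'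 τ₁)) → (∀ i : Fin d.N, ∃ δ T : ℝ, 0 < δ ∧ ∀ (R' : Fin d.N → ℝ → ℝ) (τ₁ : ℝ), ∀ x ∈ (Kerr.exterior (M i) (a i) : Set E4), Kerr.radius (a i) x < Kerr.rPlus (M i) (a i) + δ → T ≤ Θ i x 0 → (d.adapted i).radius (Θ i x) ≤ R i (Θ i x 0) → x 0 ≤ τ₁ → Kerr.rPlus (M i) (a i) + 1 ≤ R' i τ₁ → ∀ h₀ : ((d.motion i).1 : E4 ≃L[ℝ] E4) (Θ i x) + (d.motion i).2 ∈ (d.background i).domain, d.toOver.chart i ⟨((d.motion i).1 : E4 ≃L[ℝ] E4) (Θ i x) + (d.motion i).2, h₀⟩ ∈ 𝓢.metric.causalPast 𝓢.timeOrientation (recutCertifiedSlab d M a Θ R' τ₁)) → (∀ s W K : ℝ, ∃ τC : ℝ, ∀ (τ₁ : ℝ) (y : d.toOver.flatDomain), τC ≤ τ₁ → τ₁ - K ≤ (y : E4) 0 → (y : E4) 0 ≤ τ₁ → d.toOver.flatChart y ∉ recutCertifiedLate d M a Θ (fun i τ ↦ R i (c i * τ - s) - W) τ₁ → d.toOver.flatChart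 y ∈ 𝓢.metric.causalPast 𝓢.timeOrientation (recutCertifiedSlab d M a Θ (fun i τ ↦ R i (c i * τ - s) - W) τ₁)) → ∃ s₁ : ℝ, ∀ s W : ℝ, s₁ ≤ s → s₁ ≤ W → ∃ τJ : ℝ, ∀ τ₁ : ℝ, τJ < τ₁ → ((𝓢.metric.causalPast 𝓢.timeOrientation (docHoleSlabs d R τ₁) ∪ docHoleTubes d R τ₁) ∩ (O ∩ 𝓢.metric.chronologicalPast 𝓢.timeOrientation (docCharted d))) \ recutCertifiedLate d M a Θ (fun i τ ↦ R i (c i * τ - s) - W) τ₁ ⊆ 𝓢.metric.causalPast 𝓢.timeOrientation (recutCertifiedSlab d M a Θ (fun i τ ↦ R i (c i * τ - s) - W) τ₁) := by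
  intro 𝓢 O k d M a c r₀ Θ R hRmono hRtop hiii hii hW hc1 hiso hb hα hNH hCF
  refine ⟨0, fun s W hs hWge ↦ ?_⟩
  -- the transported radii, read with `cᵢ = 1`
  set R' : Fin d.N → ℝ → ℝ := fun i τ ↦ R i (c i * τ - s) - W with hR'_def
  have hR' : ∀ i τ, R' i τ = R i (τ - s) - W := fun i τ ↦ by simp [hR'_def, hc1 i]
  have h2le : (2 : ℕ∞ω) ≤ ((⊤ : ℕ∞) : ℕ∞ω) := WithTop.coe_le_coe.mpr le_top
  -- constants of the identifications: tilt / radius comparison `L`, offsets `κ`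
  have hglob := fun i ↦ kerrChartedWith_global_bounds (hW i)
  choose L₁ hL₁0 hL₁ using hglob
  have hrad := fun i ↦ radius_le_adaptedRadius_add_w5 (hW i)
  choose L₂ hL₂0 hL₂ using hrad
  obtain ⟨L', hL'⟩ := Finite.exists_le fun i ↦ max (L₁ i) (L₂ i)
  obtain ⟨κ', hκ'⟩ := Finite.exists_le fun i : Fin d.N ↦ |(d.motion i).2 0|
  set L : ℝ := max L' 0 with hL_def; set κ : ℝ := max κ' 0 with hκ_def
  have hL0 : 0 ≤ L := le_max_right _ _; have hκ0 : 0 ≤ κ := le_max_right _ _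
  have hκi : ∀ i, |(d.motion i).2 0| ≤ κ := fun i ↦ (hκ' i).trans (le_max_left _ _)
  have htilt : ∀ i, ∀ u ∈ (Kerr.exterior (M i) (a i) : Set E4), |Θ i u 0 - u 0| ≤ L := fun i u hu ↦ by
    have h := (hL₁ i u hu).1
    rw [hc1 i, one_mul] at h
    exact h.trans ((le_max_left _ _).trans ((hL' i).trans (le_max_left _ _)))
  have hradle : ∀ i, ∀ u ∈ (Kerr.exterior (M i) (a i) : Set E4),
      Kerr.radius (a i) u ≤ (d.adapted i).radius (Θ i u) + L := fun i u hu ↦ by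
    have h1 : L₂ i ≤ L := (le_max_right _ _).trans ((hL' i).trans (le_max_left _ _))
    linarith [hL₂ i u hu]
  -- the steering data of (α), (NH) and case F
  choose δ TN hδ hTN using hNH
  have hα' := fun i ↦ hα i (δ i) (hδ i)
  choose Tα hTα using hα'
  obtain ⟨τC, hτC⟩ := hCF s W (L + 3 * κ + 1)
  -- clause (iii) with margins `(W + L, s + L)`
  have hiii' := fun i ↦ eventually_atTop.1 ((hiii i (W + L) (s + L)).and (eventually_gt_atTop d.toOver.τ₀))
  choose Sg hSg using hiii'
  -- growth of the radii
  have hgrow := fun i ↦ eventually_atTop.1 ((hRtop i).eventually_ge_atTop (Kerr.rPlus (M i) (a i) + 1 + W))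
  choose TR hTR using hgrow
  obtain ⟨T₁, hT₁⟩ := Finite.exists_le fun i ↦ max (max (Sg i) (TR i + s)) (max (TN i) (Tα i))
  set T₀ : ℝ := max (max τC d.toOver.τ₀) T₁ with hT₀
  refine ⟨T₀ + L + 3 * κ + 2, fun τ₁ hτ₁ ↦ ?_⟩
  have hT₀C : τC ≤ T₀ := (le_max_left _ _).trans (le_max_left _ _)
  have hT₀τ : d.toOver.τ₀ ≤ T₀ := (le_max_right _ _).trans (le_max_left _ _); have hT₀1 : T₁ ≤ T₀ := le_max_right _ _
  have hi1 : ∀ i, Sg i ≤ T₁ ∧ TR i + s ≤ T₁ ∧ TN i ≤ T₁ ∧ Tα i ≤ T₁ := fun i ↦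
    ⟨(le_max_left _ _).trans ((le_max_left _ _).trans (hT₁ i)),
      (le_max_right _ _).trans ((le_max_left _ _).trans (hT₁ i)),
      (le_max_left _ _).trans ((le_max_right _ _).trans (hT₁ i)),
      (le_max_right _ _).trans ((le_max_right _ _).trans (hT₁ i))⟩
  set τ₂ : ℝ := τ₁ - L - 2 * κ - 1 with hτ₂
  have hτ₂T : T₀ + κ + 1 < τ₂ := by rw [hτ₂]; linarith
  have hτ₂τ₀ : d.toOver.τ₀ < τ₂ := by linarith
  have hτC₁ : τC ≤ τ₁ := by linarith
  -- the Ω-test at `τ₁`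
  have hΩtest : ∀ y : d.toOver.flatDomain, d.toOver.τ₀ < (y : E4) 0 → (y : E4) 0 ≤ τ₁ - L - κ →
      d.toOver.flatChart y ∉ recutCertifiedLate d M a Θ R' τ₁ := fun y hy₀ hy₁ ↦
    flatChart_not_mem_recutCertifiedLate d hiso hb htilt hκi R' (by linarith) hL0 hκ0 y hy₀ hy₁
  -- §3: steering of a late d.o.c.-part hole coordinate in the old certified tube
  have holePoint : ∀ (i : Fin d.N) (y : (d.background i).domain), y ∈ docPart d i →
      τ₂ ≤ (d.background i).time y.1 →
      (d.background i).radius y.1 ≤ R i ((d.background i).time y.1) →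
      (d.toOver.chart i y ∉ recutCertifiedLate d M a Θ R' τ₁ ∨ (d.background i).time y.1 ≤ τ₂) →
        d.toOver.chart i y ∈ 𝓢.metric.causalPast 𝓢.timeOrientation (recutCertifiedSlab d M a Θ R' τ₁) := by
    intro i y hydoc hyσ hyR hΩ
    obtain ⟨x, hx, hΘx⟩ := exists_kerr_of_mem_docPart_w5 d (hW i) hydoc
    set σ : ℝ := (d.background i).time y.1 with hσ_def
    have hΘx0 : Θ i x 0 = σ := by rw [hΘx, hσ_def]; rfl
    have hσlate : d.toOver.τ₀ < σ := by linarith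
    have hlab : (y : E4) 0 = σ + (d.motion i).2 0 := by
      have h := poincareInv_apply_zero_w5 (hiso i) (d.motion i).2 (y : E4)
      rw [hσ_def]
      show (y : E4) 0 = (poincareInv (d.motion i).1 (d.motion i).2 (y : E4)) 0 + (d.motion i).2 0
      rw [h]; ring
    have hc0 := abs_le.1 (hκi i)
    have hylab : d.toOver.τ₀ < (y : E4) 0 := by rw [hlab]; linarith
    have hx0 := abs_le.1 (htilt i x hx)
    rw [hΘx0] at hx0
    obtain ⟨hSg1, hTR1, hTN1, hTα1⟩ := hi1 i
    have hσSg : Sg i ≤ σ := by linarith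
    have hPy : ((d.motion i).1 : E4 ≃L[ℝ] E4) (Θ i x) + (d.motion i).2 = (y : E4) := by
      rw [hΘx, apply_poincareInv_add]
    have hAR : (d.adapted i).radius (Θ i x) ≤ R i (Θ i x 0) := by rw [hΘx0, hΘx]; exact hyR
    have hgrow1 : Kerr.rPlus (M i) (a i) + 1 ≤ R' i τ₁ := by
      rw [hR']; linarith [hTR i (τ₁ - s) (by linarith)]
    -- the generic steering step from the Kerr–Schild data
    have steer : x 0 ≤ τ₁ → Kerr.radius (a i) x ≤ R' i τ₁ →
        d.toOver.chart i y ∈ 𝓢.metric.causalPast 𝓢.timeOrientation (recutCertifiedSlab d M a Θ R' τ₁) := by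
      intro h3 h2
      have key : ∀ y' : (d.background i).domain,
          (y' : E4) = ((d.motion i).1 : E4 ≃L[ℝ] E4) (Θ i x) + (d.motion i).2 →
            d.toOver.chart i y' ∈ 𝓢.metric.causalPast 𝓢.timeOrientation (recutCertifiedSlab d M a Θ R' τ₁) := by
        rintro ⟨v, hv⟩ rfl
        by_cases hr : Kerr.rPlus (M i) (a i) + δ i ≤ Kerr.radius (a i) x
        · exact hTα i R' τ₁ x hx hr (by rw [hΘx0]; linarith) hAR h3 h2 hv
        · exact hTN i R' τ₁ x hx (not_le.1 hr) (by rw [hΘx0]; linarith) hAR h3 hgrow1 hv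
      have h := key ⟨(y : E4), y.2⟩ hPy.symm
      exact h
    -- membership in `Ω` from the Kerr–Schild data
    have omega : τ₁ < x 0 → Kerr.radius (a i) x ≤ R' i (x 0) →
        d.toOver.chart i y ∈ recutCertifiedLate d M a Θ R' τ₁ := by
      intro h0 hr
      have key : ∀ y' : (d.background i).domain,
          (y' : E4) = ((d.motion i).1 : E4 ≃L[ℝ] E4) (Θ i x) + (d.motion i).2 →
            d.toOver.chart i y' ∈ recutCertifiedLate d M a Θ R' τ₁ := by
        rintro ⟨v, hv⟩ rfl
        exact chart_mem_recutCertifiedLate_of_kerr_w5 d R' hx h0 hr hv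
      exact key ⟨(y : E4), y.2⟩ hPy.symm
    -- far points are flat events of lab time `σ + cᵢ⁰`: case F
    have far : R i (σ - L - s) - W - L < (d.adapted i).radius (Θ i x) →
        d.toOver.chart i y ∉ recutCertifiedLate d M a Θ R' τ₁ →
        d.toOver.chart i y ∈ 𝓢.metric.causalPast 𝓢.timeOrientation (recutCertifiedSlab d M a Θ R' τ₁) := by
      intro hfar hΩ'
      obtain ⟨hsub, -⟩ := hSg i σ hσSg
      have hmem : d.toOver.chart i y ∈ d.toOver.radiationZone := by
        refine hsub (mem_image_of_mem _ ⟨⟨rfl, ?_⟩, hydoc⟩)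
        show R i (σ - (s + L)) - (W + L) ≤ (d.adapted i).radius (poincareInv (d.motion i).1 (d.motion i).2 y.1)
        rw [← hΘx]
        have : σ - (s + L) = σ - L - s := by ring
        rw [this]; linarith
      obtain ⟨y'', hy'', heq⟩ := hmem
      have hyy : (y : E4) = y'' := hb i y y'' hσlate hylab hy'' heq.symm
      have hy''0 : (y'' : E4) 0 = σ + (d.motion i).2 0 := by rw [← hyy, hlab]
      rw [← heq] at hΩ' ⊢
      by_cases hlate : τ₁ < (y'' : E4) 0
      · exact (hΩ' (Or.inl (mem_image_of_mem _ (show τ₁ < (y'' : E4) 0 from hlate)))).elim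
      · exact hτC τ₁ y'' hτC₁ (by rw [hy''0]; linarith) (not_lt.1 hlate) hΩ'
    -- case analysis on the Kerr–Schild data
    by_cases h3 : x 0 ≤ τ₁
    · by_cases h2 : Kerr.radius (a i) x ≤ R' i τ₁
      · exact steer h3 h2
      · have hfar : R i (σ - L - s) - W - L < (d.adapted i).radius (Θ i x) := by
          have hmono : R i (σ - L - s) ≤ R i (τ₁ - s) := hRmono i (by linarith)
          rw [hR'] at h2
          linarith [hradle i x hx, not_le.1 h2]
        refine far hfar (hΩ.elim id fun hle ↦ ?_)
        -- `σ = τ₂`: the flat label has lab time `≤ τ₁ − L − κ`: Ω-test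
        intro hmemΩ
        obtain ⟨hsub, -⟩ := hSg i σ hσSg
        have hmem : d.toOver.chart i y ∈ d.toOver.radiationZone := by
          refine hsub (mem_image_of_mem _ ⟨⟨rfl, ?_⟩, hydoc⟩)
          show R i (σ - (s + L)) - (W + L) ≤ (d.adapted i).radius (poincareInv (d.motion i).1 (d.motion i).2 y.1)
          rw [← hΘx]
          have : σ - (s + L) = σ - L - s := by ring
          rw [this]; linarith
        obtain ⟨y'', hy'', heq⟩ := hmem
        have hyy : (y : E4) = y'' := hb i y y'' hσlate hylab hy'' heq.symm
        have hy''0 : (y'' : E4) 0 = σ + (d.motion i).2 0 := by rw [← hyy, hlab]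
        rw [← heq] at hmemΩ
        exact hΩtest y'' hy'' (by rw [hy''0]; linarith) hmemΩ
    · push Not at h3
      by_cases h2 : Kerr.radius (a i) x ≤ R' i (x 0)
      · -- the point is in `Ω`: excluded by either hypothesis
        exact hΩ.elim (fun hΩ ↦ (hΩ (omega h3 h2)).elim) fun hle ↦ by exfalso; linarith
      · have hfar : R i (σ - L - s) - W - L < (d.adapted i).radius (Θ i x) := by
          have hmono : R i (σ - L - s) ≤ R i (x 0 - s) := hRmono i (by linarith)
          rw [hR'] at h2
          linarith [hradle i x hx, not_le.1 h2]
        refine far hfar (hΩ.elim id fun hle ↦ ?_)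
        exfalso; linarith
  -- §4: the four branches of clause (ii) at `τ₂`
  rintro p ⟨⟨-, hpO⟩, hpΩ⟩
  by_cases hp2 : p ∈ docCertifiedLate d R τ₂
  · rw [docCertifiedLate_eq] at hp2
    rcases hp2 with ⟨y, hy, rfl⟩ | hp3
    · -- (1) `p` is flat-late after `τ₂`
      have hy₂ : τ₂ < (y : E4) 0 := hy
      by_cases hy₁ : τ₁ < (y : E4) 0
      · exact (hpΩ (Or.inl (mem_image_of_mem _ (show τ₁ < (y : E4) 0 from hy₁)))).elim
      · exact hτC τ₁ y hτC₁ (by linarith) (not_lt.1 hy₁) hpΩ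
    · -- (3) `p` in an old d.o.c. tube after `τ₂`
      obtain ⟨i, hi⟩ := mem_iUnion.1 hp3
      obtain ⟨y, ⟨⟨hyt, hyr⟩, hydoc⟩, rfl⟩ := hi
      exact holePoint i y hydoc hyt.le hyr (Or.inl hpΩ)
  · have hp4 := hii τ₂ hτ₂τ₀ ⟨hpO, hp2⟩
    rw [docCertifiedSlab_eq] at hp4
    rcases causalPast_union_subset _ _ hp4 with hflat | hslab
    · -- (2) `p` below a flat slab point `q` of lab time `τ₂`
      obtain ⟨q, ⟨y, hy, rfl⟩, hpq⟩ := exists_mem_causalPast_singleton_w5 hflat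
      have hy₂ : (y : E4) 0 = τ₂ := hy
      have hq : d.toOver.flatChart y ∈ 𝓢.metric.causalPast 𝓢.timeOrientation (recutCertifiedSlab d M a Θ R' τ₁) :=
        hτC τ₁ y hτC₁ (by linarith) (by linarith)
          (hΩtest y (by linarith) (by linarith))
      exact causalPast_subset_causalPast_of_subset_w5 h2le (singleton_subset_iff.2 hq) hpq
    · -- (4) `p` below an old d.o.c. slab point `q` at `τ₂`
      obtain ⟨q, hq, hpq⟩ := exists_mem_causalPast_singleton_w5 hslab
      obtain ⟨i, hi⟩ := mem_iUnion.1 hq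
      obtain ⟨y, ⟨⟨hyt, hyr⟩, hydoc⟩, rfl⟩ := hi
      have hyt' : (d.background i).time y.1 = τ₂ := hyt
      have hq' := holePoint i y hydoc hyt'.ge (by rw [hyt']; exact hyr) (Or.inr hyt'.le)
      exact causalPast_subset_causalPast_of_subset_w5 h2le (singleton_subset_iff.2 hq') hpq

end Summit.FinalStateConjecture.FinalStateConjecture.Theorems.SymplecticDualOfTheBomb

end
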